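import Summits.ABC.ABC.Theorems.CongruentialReceptacleTameLocalReceptacleEngineCellsDefs
import Summits.ABC.ABC.Theorems.CongruentialReceptacleTameLocalReceptacleStubKeyCellsOfCellLaws
import Summits.ABC.ABC.Theorems.CongruentialReceptacleTameLocalReceptacleStubTiltBound

/-!
# Crux `TameLocalReceptacle` (stmt-ABC-14354), line `grh-friable-cell-resolution`:
# family-level cell targets ⇒ key-cell structure

Registered stub `stub_keyCellStructure_of_cells : CECells → VMCells → TailCells → NonemptyCells → KeyCellStructure (1/4)`
of the checked skeleton `Cruxes/TameLocalReceptacle/Lines/grh_friable_cell_resolution.lean` (lead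
`prover-line-stmt-ABC-14354-a1-0`).  Pure finite-sum bookkeeping over `…KeyCellDefs.lean` (`intensity`, `cellMass`,
`classDiscrepancy`, `valuationDiscrepancy`, `KeyCellStructure`, `stub_admMass`), `…CellLawsDefs.lean` (`TailSmall`,
`FriableMembers`, `InadmissibleVanish`), `…FamiliesDefs.lean` (`FAfam_spec`, `FBfam_spec`, `FCfam_spec`) and
`…EngineCellsDefs.lean` (`levelOf`, `shallowOf`, `famFA … famG'`, `CECells`, `VMCells`, `TailCells`, `NonemptyCells`),
reusing `KeyCellBook.*`, `CellLawsBook.*` and `TiltBook.keyWeight_exps`; the new facts live in the sub-namespace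
`EngineCellsBook`.
* AVERAGING (`abs_sub_avg_le`): in a cell whose inadmissible classes vanish, an intensity within `ε` of every
  admissible intensity is within `ε` of the cell average `cellMass/(q−1)²` (`#adm = (q−1)²`, `stub_admMass`).
* ONE CELL (`ce_cell_le_of_cells`): the class sum of (CE) is `≤ keyWeight·(q−1)²·ε` on a shallow cell at a prime
  `q ≤ y` (averaging), and `≤ 2·keyWeight·cellMass` otherwise (`CellLawsBook.ce_cell_le` at the model value `0`),
  i.e. twice the `TailSmall` term, or `0` above the friability bound (`CellLawsBook.cellMass_eq_zero_of_lt`).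
* COUNTING (`shallow_budget_le`): at most `y + 1` primes `q ≤ y`, at most `y⁴` shallow valuations
  (`v + 1 ≤ q^{v+1} ≤ y⁴`), weights `(v+1) log q ≤ y⁴·y`, `(q−1)² ≤ y²`: the shallow (CE) budget is `≤ (y+1)^{12} ε`;
  hence `classDiscrepancy ≤ (y+1)^{12} ε + 2e` (`ce_le_of_cells`) and `valuationDiscrepancy ≤ shallowVD + 2e`
  (`vm_le_of_cells`).
* GROWTH (`succ_pow_le_of_growth`, `levelOf_facts`): at a scale `M ≥ max (48·2^N) e²`, `y = levelOf N M ≥ 2` and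
  `(y+1)^{12} ≤ (log M)^A` for `A = 24K + 12`, `K = 10⁵` (`log x ≤ 2 log M`, `y ≤ (log x)^K`).
* The stub: `V₀ := 1`; depth `N := N₁ + 1 + ⌈(max A₀ 0 + 4)/δ⌉₊`; `A := 24K + 12`; tails `e := 1/2`; `M` beyond the
  four thresholds and `max (48·2^N) ⌈e²⌉₊`; witnesses `famFA N M, …, famG' N M`; shape clauses from the `*_spec`
  lemmas; (CE) `≤ 1 + 1 ≤ δN`, (VM) `≤ A₀ + 1 ≤ δN`.
-/

-- `Summit.<Summit>.<Problem>` is the mandated summit-side namespace (CONVENTIONS §2); for the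
-- single-conjunct summit `ABC` the two coincide, so the duplicate `ABC.ABC` is deliberate.
set_option linter.dupNamespace false

noncomputable section

namespace Summit.ABC.ABC.Theorems.TameLocalReceptacle

open Finset Literature.NumberTheory.DiophantineGeometry KeyCellBook CellLawsBook

namespace EngineCellsBook

/-! ### One cell: averaging and the class sum of (CE) -/

/-- AVERAGING.  If the inadmissible classes of the cell `(q, v)` carry no intensity and the intensity of the class
`(r, s, z)` is within `ε` of that of every admissible class, then it is within `ε` of the cell average
`cellMass/(q−1)²` over the `(q−1)²` admissible classes (`stub_admMass`): `(q−1)²·I − cellMass = Σ_{adm} (I − I')`.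
[folklore] -/
theorem abs_sub_avg_le (F : Finset (ℕ × ℕ × ℕ)) (P : Pos) {q : ℕ} (hq : q.Prime) (v : ℕ) {ε : ℝ} {r s z : ℕ}
    (hIV : ∀ r' s' z', P.adm q r' s' z' = false → intensity F P q (mkDatum (P.exps v) r' s' z') = 0)
    (h : ∀ r' s' z', P.adm q r' s' z' = true →
      |intensity F P q (mkDatum (P.exps v) r s z) - intensity F P q (mkDatum (P.exps v) r' s' z')| ≤ ε) :
    |intensity F P q (mkDatum (P.exps v) r s z) - cellMass F P q v / ((q : ℝ) - 1) ^ 2| ≤ ε := by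
  have hD : (0 : ℝ) < ((q : ℝ) - 1) ^ 2 := by
    have h2 : (2 : ℝ) ≤ q := by exact_mod_cast hq.two_le
    exact pow_pos (by linarith) 2
  refine le_of_mul_le_mul_left ?_ hD
  rw [← abs_of_pos hD, ← abs_mul, abs_of_pos hD, mul_sub, mul_div_cancel₀ _ hD.ne',
    ← sum_box_ite P hq.one_le (intensity F P q (mkDatum (P.exps v) r s z)), ← sum_box_ite P hq.one_le ε]
  unfold cellMass
  simp only [← Finset.sum_sub_distrib]
  refine abs_sum_le_of_le fun r' _ => abs_sum_le_of_le fun s' _ => abs_sum_le_of_le fun z' _ => ?_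
  by_cases ha : P.adm q r' s' z' = true
  · rw [if_pos ha, if_pos ha]
    exact h r' s' z' ha
  · rw [if_neg ha, if_neg ha, hIV r' s' z' (by simpa using ha)]
    simp

/-- ONE CELL.  The class sum of (CE) in the cell `(q, v)`: on a shallow cell (`q^{v+1} ≤ Y`) at a prime `q ≤ y` every
class is within `𝟙[adm]·ε` of the class-uniform model (inadmissible classes vanish on both sides; admissible ones by
`abs_sub_avg_le`), so the sum is `≤ keyWeight·(q−1)²·ε`; otherwise it is `≤ 2·keyWeight·cellMass`
(`CellLawsBook.ce_cell_le` at the model value `0`), i.e. twice the `TailSmall` term, or `0` above the friability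
bound. [folklore] -/
theorem ce_cell_le_of_cells (F : Finset (ℕ × ℕ × ℕ)) (P : Pos) {q : ℕ} (hq : q.Prime) (v : ℕ) {y Y : ℕ} {ε : ℝ}
    (hIV : ∀ r s z, P.adm q r s z = false → intensity F P q (mkDatum (P.exps v) r s z) = 0)
    (hC : q ≤ y → q ^ (v + 1) ≤ Y → ∀ r s z r' s' z', P.adm q r s z = true → P.adm q r' s' z' = true →
      |intensity F P q (mkDatum (P.exps v) r s z) - intensity F P q (mkDatum (P.exps v) r' s' z')| ≤ ε)
    (hfar : y < q → cellMass F P q v = 0) :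
    ∑ r ∈ range q, ∑ s ∈ range q, ∑ z ∈ range q, keyWeight (P.exps v) q *
        |intensity F P q (mkDatum (P.exps v) r s z) -
          (if P.adm q r s z then cellMass F P q v / ((q : ℝ) - 1) ^ 2 else 0)| ≤
      (if q ≤ y ∧ q ^ (v + 1) ≤ Y then keyWeight (P.exps v) q * (((q : ℝ) - 1) ^ 2 * ε) else 0) +
        2 * (if q ^ (v + 1) ≤ Y then 0 else keyWeight (P.exps v) q * cellMass F P q v) := by
  have hkW := keyWeight_nonneg (P.exps v) q
  by_cases hsh : q ≤ y ∧ q ^ (v + 1) ≤ Y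
  · rw [if_pos hsh, if_pos hsh.2, mul_zero, add_zero, ← sum_box_ite P hq.one_le ε]
    simp only [Finset.mul_sum]
    refine Finset.sum_le_sum fun r _ => Finset.sum_le_sum fun s _ => Finset.sum_le_sum fun z _ =>
      mul_le_mul_of_nonneg_left ?_ hkW
    by_cases ha : P.adm q r s z = true
    · rw [if_pos ha, if_pos ha]
      exact abs_sub_avg_le F P hq v hIV fun r' s' z' h' => hC hsh.1 hsh.2 r s z r' s' z' ha h'
    · rw [if_neg ha, if_neg ha, hIV r s z (by simpa using ha)]
      simp
  · rw [if_neg hsh, zero_add]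
    have h := ce_cell_le F P hq v 0
    rw [show (∑ r ∈ range q, ∑ s ∈ range q, ∑ z ∈ range q, |intensity F P q (mkDatum (P.exps v) r s z) -
        (if P.adm q r s z = true then (0 : ℝ) else 0)|) = cellMass F P q v by
      simp [abs_of_nonneg, intensity_nonneg, cellMass]] at h
    by_cases hY : q ^ (v + 1) ≤ Y
    · calc _ ≤ 2 * (keyWeight (P.exps v) q * cellMass F P q v) := h
        _ = 2 * (if q ^ (v + 1) ≤ Y then 0 else keyWeight (P.exps v) q * cellMass F P q v) := by
            rw [if_pos hY, hfar (not_le.1 fun hqy => hsh ⟨hqy, hY⟩)]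
            ring
    · rwa [if_neg hY]

/-! ### Summing over the cells -/

/-- COUNTING.  The shallow (CE) budget: at most `y + 1` primes `q ≤ y`, at most `y⁴` shallow valuations
(`v + 1 ≤ q^{v+1} ≤ y⁴`), weights `(v+1) log q ≤ y⁴·y` (`TiltBook.keyWeight_exps`) and `(q−1)² ≤ y²`, so the total
is `≤ (y+1)·y⁴·(y⁴·y)·(y²·ε) ≤ (y+1)^{12} ε`. [folklore] -/
theorem shallow_budget_le (P : Pos) (Q V y : ℕ) {ε : ℝ} (hε : 0 ≤ ε) :
    ∑ q ∈ oddPrimesBelow Q, ∑ v ∈ Icc 1 V,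
        (if q ≤ y ∧ q ^ (v + 1) ≤ y ^ 4 then keyWeight (P.exps v) q * (((q : ℝ) - 1) ^ 2 * ε) else 0) ≤
      ((y : ℝ) + 1) ^ 12 * ε := by
  -- pointwise: `𝟙[q ≤ y] · 𝟙[v < y⁴] · (y⁴·y)·(y²·ε)`
  have hpt : ∀ q ∈ oddPrimesBelow Q, ∀ v ∈ Icc 1 V,
      (if q ≤ y ∧ q ^ (v + 1) ≤ y ^ 4 then keyWeight (P.exps v) q * (((q : ℝ) - 1) ^ 2 * ε) else 0) ≤
        (if q < y + 1 then (1 : ℝ) else 0) *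
          ((if v < y ^ 4 then (1 : ℝ) else 0) * (((y : ℝ) ^ 4 * y) * ((y : ℝ) ^ 2 * ε))) := by
    intro q hq v _
    have hqp := prime_of_mem_oddPrimesBelow hq
    by_cases hsh : q ≤ y ∧ q ^ (v + 1) ≤ y ^ 4
    · obtain ⟨hqy, hvY⟩ := hsh
      have hv1 : v + 1 < y ^ 4 := (Nat.lt_pow_self hqp.one_lt).trans_le hvY
      rw [if_pos ⟨hqy, hvY⟩, if_pos (Nat.lt_succ_of_le hqy), if_pos (Nat.lt_of_succ_lt hv1), one_mul, one_mul,
        TiltBook.keyWeight_exps]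
      have hvR : (v : ℝ) + 1 ≤ (y : ℝ) ^ 4 := by exact_mod_cast hv1.le
      have hqR : (q : ℝ) ≤ y := by exact_mod_cast hqy
      have h2 : (2 : ℝ) ≤ q := by exact_mod_cast hqp.two_le
      have hlog : Real.log q ≤ y := (Real.log_le_self (Nat.cast_nonneg q)).trans hqR
      have hsq : ((q : ℝ) - 1) ^ 2 ≤ (y : ℝ) ^ 2 := pow_le_pow_left₀ (by linarith) (by linarith) 2
      exact mul_le_mul (mul_le_mul hvR hlog (Real.log_natCast_nonneg q) (by positivity))
        (mul_le_mul_of_nonneg_right hsq hε) (by positivity) (by positivity)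
    · rw [if_neg hsh]
      positivity
  -- counting the primes `q ≤ y` and the valuations `v < y⁴`
  have hcq : ∑ q ∈ oddPrimesBelow Q, (if q < y + 1 then (1 : ℝ) else 0) ≤ (y : ℝ) + 1 := by
    rw [Finset.sum_boole]
    exact_mod_cast (Finset.card_le_card fun q h => Finset.mem_range.2 (Finset.mem_filter.1 h).2).trans
      (Finset.card_range (y + 1)).le
  have hcv : ∑ v ∈ Icc 1 V, (if v < y ^ 4 then (1 : ℝ) else 0) ≤ (y : ℝ) ^ 4 := by
    rw [Finset.sum_boole]
    exact_mod_cast (Finset.card_le_card fun v h => Finset.mem_range.2 (Finset.mem_filter.1 h).2).trans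
      (Finset.card_range (y ^ 4)).le
  have hy0 : (0 : ℝ) ≤ y := Nat.cast_nonneg y
  calc _ ≤ ∑ q ∈ oddPrimesBelow Q, ∑ v ∈ Icc 1 V, (if q < y + 1 then (1 : ℝ) else 0) *
          ((if v < y ^ 4 then (1 : ℝ) else 0) * (((y : ℝ) ^ 4 * y) * ((y : ℝ) ^ 2 * ε))) :=
        Finset.sum_le_sum fun q hq => Finset.sum_le_sum fun v hv => hpt q hq v hv
    _ = (∑ q ∈ oddPrimesBelow Q, (if q < y + 1 then (1 : ℝ) else 0)) *
          ((∑ v ∈ Icc 1 V, (if v < y ^ 4 then (1 : ℝ) else 0)) * (((y : ℝ) ^ 4 * y) * ((y : ℝ) ^ 2 * ε))) := by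
        rw [Finset.sum_mul]
        refine Finset.sum_congr rfl fun q _ => ?_
        rw [Finset.sum_mul, Finset.mul_sum]
    _ ≤ ((y : ℝ) + 1) * ((y : ℝ) ^ 4 * (((y : ℝ) ^ 4 * y) * ((y : ℝ) ^ 2 * ε))) :=
        mul_le_mul hcq (mul_le_mul_of_nonneg_right hcv (by positivity)) (by positivity) (by positivity)
    _ = (((y : ℝ) + 1) * (y : ℝ) ^ 11) * ε := by ring
    _ ≤ (((y : ℝ) + 1) * ((y : ℝ) + 1) ^ 11) * ε :=
        mul_le_mul_of_nonneg_right
          (mul_le_mul_of_nonneg_left (pow_le_pow_left₀ hy0 (by linarith) 11) (by positivity)) hε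
    _ = ((y : ℝ) + 1) ^ 12 * ε := by ring

/-- **(CE) from the cell targets.**  For a family of abc-triples with friable members (prime factors `≤ y`), whose
admissible intensities in every shallow cell (`q^{v+1} ≤ y⁴`) at a prime `q ≤ y` are within `ε` of each other, and
whose tails beyond `y⁴` are `≤ e`: `classDiscrepancy ≤ (y+1)^{12} ε + 2e` (`ce_cell_le_of_cells` summed, inadmissible
classes vanishing by `inadmissibleVanish_of_abc`, `shallow_budget_le`, `TailSmall`). [folklore] -/
theorem ce_le_of_cells {F : Finset (ℕ × ℕ × ℕ)} {y : ℕ} {ε e : ℝ} (hε : 0 ≤ ε)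
    (habc : ∀ T ∈ F, IsABCTriple T.1 T.2.1 T.2.2) (hfr : FriableMembers y F)
    (hC : ∀ (P : Pos) (q v r s z r' s' z' : ℕ), q.Prime → q ≠ 2 → q ≤ y → 1 ≤ v → q ^ (v + 1) ≤ y ^ 4 →
      P.adm q r s z = true → P.adm q r' s' z' = true →
      |intensity F P q (mkDatum (P.exps v) r s z) - intensity F P q (mkDatum (P.exps v) r' s' z')| ≤ ε)
    (hT : TailSmall e (y ^ 4) F) (P : Pos) (Q V : ℕ) :
    classDiscrepancy F P Q V ≤ ((y : ℝ) + 1) ^ 12 * ε + 2 * e := by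
  have hIV := inadmissibleVanish_of_abc habc
  unfold classDiscrepancy
  calc _ ≤ ∑ q ∈ oddPrimesBelow Q, ∑ v ∈ Icc 1 V,
          ((if q ≤ y ∧ q ^ (v + 1) ≤ y ^ 4 then keyWeight (P.exps v) q * (((q : ℝ) - 1) ^ 2 * ε) else 0) +
            2 * (if q ^ (v + 1) ≤ y ^ 4 then 0 else keyWeight (P.exps v) q * cellMass F P q v)) :=
        Finset.sum_le_sum fun q hq => Finset.sum_le_sum fun v hv => by
          have hqp := prime_of_mem_oddPrimesBelow hq
          have hq2 : q ≠ 2 := (Finset.mem_filter.1 hq).2.2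
          have hv1 : 1 ≤ v := (Finset.mem_Icc.1 hv).1
          exact ce_cell_le_of_cells F P hqp v (fun r s z h => hIV P q v r s z hqp hq2 hv1 h)
            (fun hqy hY r s z r' s' z' h h' => hC P q v r s z r' s' z' hqp hq2 hqy hv1 hY h h')
            (fun hyq => cellMass_eq_zero_of_lt habc hfr hyq P v)
    _ ≤ ((y : ℝ) + 1) ^ 12 * ε + 2 * e := by
        simp only [Finset.sum_add_distrib, ← Finset.mul_sum]
        linarith [shallow_budget_le P Q V y hε, hT P Q V]

/-- **(VM) from the cell targets**: `valuationDiscrepancy ≤ shallowVD + tail_F + tail_G ≤ A₀ + 2e` (per cell, the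
non-shallow term `keyWeight·|cm_F − cm_G|` is at most `keyWeight·cm_F + keyWeight·cm_G`). [folklore] -/
theorem vm_le_of_cells {F G : Finset (ℕ × ℕ × ℕ)} {Y : ℕ} {A₀ e : ℝ} {P : Pos} {Q V : ℕ}
    (hsh : shallowVD Y F G P Q V ≤ A₀) (hF : TailSmall e Y F) (hG : TailSmall e Y G) :
    valuationDiscrepancy F G P Q V ≤ A₀ + 2 * e := by
  have h1 := hF P Q V
  have h2 := hG P Q V
  unfold shallowVD at hsh
  unfold valuationDiscrepancy
  calc _ ≤ ∑ q ∈ oddPrimesBelow Q, ∑ v ∈ Icc 1 V,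
          ((if q ^ (v + 1) ≤ Y then keyWeight (P.exps v) q * |cellMass F P q v - cellMass G P q v| else 0) +
            (if q ^ (v + 1) ≤ Y then 0 else keyWeight (P.exps v) q * cellMass F P q v) +
            (if q ^ (v + 1) ≤ Y then 0 else keyWeight (P.exps v) q * cellMass G P q v)) :=
        Finset.sum_le_sum fun q _ => Finset.sum_le_sum fun v _ => by
          split_ifs with h
          · simp
          · rw [zero_add, ← mul_add]
            refine mul_le_mul_of_nonneg_left (abs_sub_le_iff.2 ⟨?_, ?_⟩) (keyWeight_nonneg _ _) <;>
              linarith [cellMass_nonneg F P q v, cellMass_nonneg G P q v]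
    _ ≤ A₀ + 2 * e := by
        simp only [Finset.sum_add_distrib]
        linarith

/-! ### Growth of the parameters -/

/-- If `2 ≤ L`, `0 ≤ X ≤ 2L` and `0 ≤ y ≤ X^K`, then `(y+1)^{12} ≤ L^{24K+12}`
(`y + 1 ≤ 2(2L)^K`, so `(y+1)^{12} ≤ 2^{12(K+1)} L^{12K} ≤ L^{12(K+1)} L^{12K}`). [folklore] -/
theorem succ_pow_le_of_growth {L X y : ℝ} {K : ℕ} (hL : 2 ≤ L) (hX0 : 0 ≤ X) (hX : X ≤ 2 * L) (hy0 : 0 ≤ y)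
    (hy : y ≤ X ^ K) : (y + 1) ^ 12 ≤ L ^ (24 * K + 12) := by
  have hL0 : 0 ≤ L := by linarith
  have h1 : y + 1 ≤ 2 * (2 * L) ^ K := by
    have := pow_le_pow_left₀ hX0 hX K
    have : (1 : ℝ) ≤ (2 * L) ^ K := one_le_pow₀ (by linarith)
    linarith
  calc (y + 1) ^ 12 ≤ (2 * (2 * L) ^ K) ^ 12 := pow_le_pow_left₀ (by linarith) h1 12
    _ = 2 ^ (12 * (K + 1)) * L ^ (12 * K) := by ring
    _ ≤ L ^ (12 * (K + 1)) * L ^ (12 * K) :=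
        mul_le_mul_of_nonneg_right (pow_le_pow_left₀ (by norm_num) hL _) (by positivity)
    _ = L ^ (24 * K + 12) := by ring

/-- THE REGIME at a scale `M ≥ max (48·2^N) e²`: `y = levelOf N M ≥ 2` and `(y+1)^{12} · (log M)^{−A} ≤ 1` for
`A = 24K + 12`, `K = 10⁵` (`log x = log (48·2^N) + log M ∈ [log M, 2 log M]`, `y ≤ (log x)^K`,
`succ_pow_le_of_growth`). [folklore] -/
theorem levelOf_facts {N M : ℕ} (hM : 48 * 2 ^ N ≤ M) (hM' : ⌈Real.exp 2⌉₊ ≤ M) :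
    2 ≤ levelOf N M ∧ ((levelOf N M : ℝ) + 1) ^ 12 * (1 / Real.log M ^ (24 * 100000 + 12)) ≤ 1 := by
  have h2N : (1 : ℝ) ≤ 2 ^ N := one_le_pow₀ (by norm_num)
  have hcM : (48 * 2 ^ N : ℝ) ≤ M := by exact_mod_cast hM
  have hM0 : (0 : ℝ) < M := by linarith
  have hL2 : 2 ≤ Real.log M := by
    rw [← Real.log_exp 2]
    exact Real.log_le_log (Real.exp_pos 2) (Nat.ceil_le.1 hM')
  have hlogx : Real.log (masterScale N M) = Real.log (48 * 2 ^ N) + Real.log M := by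
    unfold masterScale
    exact Real.log_mul (by positivity) hM0.ne'
  have hc0 : 0 ≤ Real.log (48 * 2 ^ N : ℝ) := Real.log_nonneg (by linarith)
  have hcL : Real.log (48 * 2 ^ N : ℝ) ≤ Real.log M := Real.log_le_log (by positivity) hcM
  have hX0 : 0 ≤ Real.log (masterScale N M) := by rw [hlogx]; linarith
  have hX1 : 1 ≤ Real.log (masterScale N M) := by rw [hlogx]; linarith
  have hX2 : Real.log (masterScale N M) ≤ 2 * Real.log M := by rw [hlogx]; linarith
  have hy : (levelOf N M : ℝ) ≤ Real.log (masterScale N M) ^ 100000 := Nat.floor_le (pow_nonneg hX0 _)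
  refine ⟨Nat.le_floor ?_, ?_⟩
  · calc ((2 : ℕ) : ℝ) = 2 := by norm_num
      _ ≤ Real.log (masterScale N M) := by rw [hlogx]; linarith
      _ ≤ Real.log (masterScale N M) ^ 100000 := le_self_pow₀ hX1 (by norm_num)
  · rw [mul_one_div]
    exact div_le_one_of_le₀ (succ_pow_le_of_growth hL2 hX0 hX2 (Nat.cast_nonneg _) hy)
      (pow_nonneg (by linarith) _)

/-- The abc-triple and friability clauses of the five witnesses (`FAfam_spec`, `FBfam_spec`, `FCfam_spec`,
`friableMembers_of_smooth`; `famG`, `famG'` are `FAfam 1 · y`). [folklore] -/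
theorem fam_laws {N M : ℕ} (hy : 2 ≤ levelOf N M) (F : Finset (ℕ × ℕ × ℕ))
    (hF : F = famFA N M ∨ F = famFB N M ∨ F = famFC N M ∨ F = famG N M ∨ F = famG' N M) :
    (∀ T ∈ F, IsABCTriple T.1 T.2.1 T.2.2) ∧ FriableMembers (levelOf N M) F := by
  rcases hF with rfl | rfl | rfl | rfl | rfl
  · exact ⟨fun T hT => (FAfam_spec hy hT).1.1, friableMembers_of_smooth fun T hT => (FAfam_spec hy hT).2.2.2.2⟩
  · exact ⟨fun T hT => (FBfam_spec hy hT).1.1, friableMembers_of_smooth fun T hT => (FBfam_spec hy hT).2.2.2⟩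
  · exact ⟨fun T hT => (FCfam_spec hy hT).1.1, friableMembers_of_smooth fun T hT => (FCfam_spec hy hT).2.2.2⟩
  · exact ⟨fun T hT => (FAfam_spec hy hT).1.1, friableMembers_of_smooth fun T hT => (FAfam_spec hy hT).2.2.2.2⟩
  · exact ⟨fun T hT => (FAfam_spec hy hT).1.1, friableMembers_of_smooth fun T hT => (FAfam_spec hy hT).2.2.2.2⟩

end EngineCellsBook

open EngineCellsBook

/-- **Registered stub `stub_keyCellStructure_of_cells`** (line `grh-friable-cell-resolution` of crux stmt-ABC-14354):
FROM THE FAMILY-LEVEL CELL TARGETS TO `KeyCellStructure (1/4)`.  `V₀ := 1`; given `δ > 0` and `N₁`, with `A₀` the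
constant of `VMCells`, take the depth `N := N₁ + 1 + ⌈(max A₀ 0 + 4)/δ⌉₊` (so `δN ≥ max A₀ 0 + 4`), the exponent
`A := 24·10⁵ + 12` in `CECells`, the tail precision `e := 1/2` in `TailCells`, and a scale `M` beyond the four
thresholds and `max (48·2^N) ⌈e²⌉₊`; the witnesses are `famFA N M, …, famG' N M`.  Nonemptiness is `NonemptyCells`,
the shape clauses are `FAfam_spec`/`FBfam_spec`/`FCfam_spec` (`v₂(abc) = 1 ≤ V₀` on `FAfam 1 · y`), the fifteen (CE)
clauses are `EngineCellsBook.ce_le_of_cells` (`≤ (y+1)^{12}(log M)^{−A} + 1 ≤ 2`, `EngineCellsBook.levelOf_facts`)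
and the nine (VM) clauses `EngineCellsBook.vm_le_of_cells` (`≤ A₀ + 1`). [folklore] -/
theorem stub_keyCellStructure_of_cells : CECells → VMCells → TailCells → NonemptyCells → KeyCellStructure (1 / 4) := by
  rintro hCE ⟨A₀, hVM⟩ hTC hNE
  refine ⟨1, fun δ hδ N₁ => ?_⟩
  -- the depth `N` and the budget `max A₀ 0 + 4 ≤ δ N`
  obtain ⟨N, hN₁, hN1, hNA⟩ : ∃ N : ℕ, N₁ ≤ N ∧ 1 ≤ N ∧ ⌈(max A₀ 0 + 4) / δ⌉₊ ≤ N :=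
    ⟨N₁ + 1 + ⌈(max A₀ 0 + 4) / δ⌉₊, by omega, by omega, by omega⟩
  have hbud : max A₀ 0 + 4 ≤ δ * N := by
    have h2 : (max A₀ 0 + 4) / δ ≤ N := (Nat.le_ceil _).trans (by exact_mod_cast hNA)
    rwa [div_le_iff₀' hδ] at h2
  have hA₀ := le_max_left A₀ 0
  have hA₀' := le_max_right A₀ 0
  -- the scale `M`
  obtain ⟨M₁, hM₁⟩ := hCE N hN1 (24 * 100000 + 12)
  obtain ⟨M₂, hM₂⟩ := hVM N hN1
  obtain ⟨M₃, hM₃⟩ := hTC N hN1 (1 / 2) one_half_pos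
  obtain ⟨M₄, hM₄⟩ := hNE N hN1
  obtain ⟨M, h₁, h₂, h₃, h₄, h₅, h₆⟩ : ∃ M : ℕ, M₁ ≤ M ∧ M₂ ≤ M ∧ M₃ ≤ M ∧ M₄ ≤ M ∧ 48 * 2 ^ N ≤ M ∧
      ⌈Real.exp 2⌉₊ ≤ M :=
    ⟨M₁ + M₂ + M₃ + M₄ + 48 * 2 ^ N + ⌈Real.exp 2⌉₊, by omega, by omega, by omega, by omega, by omega, by omega⟩
  obtain ⟨hy2, hgr⟩ := levelOf_facts h₅ h₆
  have hε : (0 : ℝ) ≤ 1 / Real.log M ^ (24 * 100000 + 12) := by positivity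
  have hC := hM₁ M h₁
  have hV := hM₂ M h₂
  obtain ⟨tA, tB, tC, tG, tG'⟩ := hM₃ M h₃
  obtain ⟨nA, nB, nC, nG, nG'⟩ := hM₄ M h₄
  -- the generic (CE) clause and the (VM) budget
  have hce : ∀ F : Finset (ℕ × ℕ × ℕ),
      (F = famFA N M ∨ F = famFB N M ∨ F = famFC N M ∨ F = famG N M ∨ F = famG' N M) →
      TailSmall (1 / 2) (shallowOf N M) F → ∀ (P : Pos) (Q V : ℕ), classDiscrepancy F P Q V ≤ δ * N := by
    intro F hF hT P Q V
    have hl := fam_laws hy2 F hF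
    have h := ce_le_of_cells hε hl.1 hl.2 (hC F hF) hT P Q V
    linarith
  have hvm : A₀ + 2 * (1 / 2) ≤ δ * N := by linarith
  refine ⟨N, hN₁, famFA N M, famFB N M, famFC N M, famG N M, famG' N M, nA, nB, nC, nG, nG',
    fun T hT => ⟨(FAfam_spec hy2 hT).1, (FAfam_spec hy2 hT).2.1⟩,
    fun T hT => ⟨(FBfam_spec hy2 hT).1, (FBfam_spec hy2 hT).2.1⟩,
    fun T hT => ⟨(FCfam_spec hy2 hT).1, (FCfam_spec hy2 hT).2.1⟩,
    fun T hT => ⟨(FAfam_spec hy2 hT).1, ((FAfam_spec hy2 hT).2.2.1 le_rfl).le⟩,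
    fun T hT => ⟨(FAfam_spec hy2 hT).1, ((FAfam_spec hy2 hT).2.2.1 le_rfl).le⟩,
    fun P Q V => ⟨hce _ (Or.inl rfl) tA P Q V, hce _ (Or.inr (Or.inl rfl)) tB P Q V,
      hce _ (Or.inr (Or.inr (Or.inl rfl))) tC P Q V, hce _ (Or.inr (Or.inr (Or.inr (Or.inl rfl)))) tG P Q V,
      hce _ (Or.inr (Or.inr (Or.inr (Or.inr rfl)))) tG' P Q V⟩, fun Q V => ?_⟩
  obtain ⟨v1, v2, v3, v4, v5, v6, v7, v8, v9⟩ := hV Q V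
  exact ⟨(vm_le_of_cells v1 tA tG').trans hvm, (vm_le_of_cells v2 tA tG).trans hvm,
    (vm_le_of_cells v3 tA tG).trans hvm, (vm_le_of_cells v4 tB tG).trans hvm,
    (vm_le_of_cells v5 tB tG').trans hvm, (vm_le_of_cells v6 tB tG).trans hvm,
    (vm_le_of_cells v7 tC tG).trans hvm, (vm_le_of_cells v8 tC tG).trans hvm,
    (vm_le_of_cells v9 tC tG').trans hvm⟩

end Summit.ABC.ABC.Theorems.TameLocalReceptacle

end
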